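import Literature.NumberTheory.EllipticCurves.PastenValuationProductTamagawaProofs
import Literature.NumberTheory.EllipticCurves.NonsplitProofs
import Literature.NumberTheory.EllipticCurves.NeronComponentIndexTypeIIIProofs
import Literature.NumberTheory.EllipticCurves.NeronComponentIndexTypeIIIstarProofs
import Literature.NumberTheory.EllipticCurves.NeronComponentIndexTypeInstarProofs
import Literature.NumberTheory.EllipticCurves.GlobalMinimalModel
import Literature.NumberTheory.DiophantineGeometry.TateAlgorithmProofs
import Literature.NumberTheory.DiophantineGeometry.ConductorAdditiveProofs
import Literature.NumberTheory.DiophantineGeometry.ConductorFactorizationProofs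
import Literature.NumberTheory.DiophantineGeometry.ConductorRingOfIntegersProofs
import Literature.NumberTheory.DiophantineGeometry.EllArithGlueProofs
import HarnessLib

/-!
# The Tamagawa-parity square lemma: `Tam(E)` odd ⇒ `N_E · |Δ_min(E)|` is a square
# (cell `b2b-bsdres`, O1 sub-cell `p = 2`; typer item (26a) = lens-4 R-SGN2 (i) core = LEMMA G7-Δ; cc-typer-4 GEN 6)

HONEST FRAMING (run/shared/lean/b2b/bsd-rank1-residual/, verbatim in every file): the goal of the cell is to DELETE
the COMBINATION-SHAPED residual classes of the Birch–Swinnerton-Dyer formula for ALL analytic-rank `≤ 1` elliptic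
curves over `ℚ` — "full BSD formula for every rank `≤ 1` curve in class `C`" assembled STRICTLY from published
theorems — so that the rank-`≤ 1` remainder becomes exactly the CONSTRUCTION-SHAPED classes, which are TYPED
(missing-input `Prop`s), NOT attempted. This is not "finishing BSD". This file is elementary BOOKKEEPING: THEOREMS
only (no `def`, no named fact, nothing asserted about a particular curve), assembled from the tree's DISCHARGED
Tate-algorithm table (`Literature.NumberTheory.EllipticCurves.NeronComponentIndex*Proofs`, `NonsplitProofs`,
`NeronComponentIndexSplitProofs`) and Ogg's formula, by which the tree DEFINES the conductor exponent
(`WeierstrassCurve.conductorExponent`, `Literature/NumberTheory/DiophantineGeometry/Conductor.lean`).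

THE LEMMA (lens-4 GEN 7 "G7-Δ", `cells/o1/ROUTES-O1.md` §4.42; refuter v11 §65 / v12 §76 (b); lens-1 GEN 9 packet C
binder `hsq`; o1 lead R-G20.8 / R-G21.3: typer item (26a), "provable now"). For every elliptic curve `E/ℚ`:
`Tam(E) = ∏_p c_p` ODD ⟹ `v_p(N_E) ≡ v_p(Δ_min) (mod 2)` for every prime `p` ⟹ `N_E · |Δ_min|` is a perfect square.
PROOF (two printed inputs, both THEOREMS of the tree): (a) the Kodaira–Néron–Tate table of the possible local
indices `c_v = [E(K_v) : E₀(K_v)]` per Kodaira type [Silverman ATAEC IV.9.4 with Rem. IV.9.3, Table 4.1 (PDF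
pp. 341–346)]: `Iₙ ↦ n` (split) or `1 / 2` by the parity of `n` (non-split), `III ↦ 2`, `Iₙ* (n ≥ 1) ↦ 2 or 4`,
`III* ↦ 2`, and the remaining types `I₀, II, IV, I₀*, IV*, II*` have an ODD number of components `m_v ∈ {1, 1, 3, 5,
7, 9}`; so `c_v` odd forces `m_v` odd (§1, `odd_numComponentsAt_of_odd_localTamagawaNumber`); (b) Ogg–Saito
`f_v = ord_v(Δ_min) + 1 − m_v` [Silverman ATAEC IV.11.1] — a DEFINITION in the tree, with `m_v ≤ ord_v(Δ_min) + 1`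
the discharged `WeierstrassCurve.numComponentsAt_le_holds` — so `f_v + ord_v(Δ_min) = 2·ord_v(Δ_min) + 1 − m_v` is
EVEN (§1, `even_ordMinimalDiscriminant_add_conductorExponent_of_odd_localTamagawaNumber`). §2 globalises over `ℚ`:
`Tam(E)` is the finite product of the `c_v` (`WeierstrassCurve.tamagawaProduct`, a `finprod` over the places of
`𝓞 ℚ`), so `Tam(E)` odd makes every `c_v` odd; `v_p(N_E) = f_p` (`factorization_conductorNorm_holds`) and
`v_p(|Δ_min|) = ord_p(Δ_min)` (`factorization_minimalDiscriminantNorm_holds`), the `𝓞 ℚ`-versus-`ℤ` bridges being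
`conductorExponent_ringOfIntegers_eq` / `ordMinimalDiscriminant_ringOfIntegers_eq_factorization`; hence every
exponent of `N_E · |Δ_min|` is even and the product is a square (`isSquare_conductorNorm_mul_minimalDiscriminantNorm`),
and for a globally minimal `W` the integer form `N_E · |minimalDiscriminantInt W| = m²`
(`exists_conductorNorm_mul_abs_minimalDiscriminantInt_eq_sq`) is EXACTLY the binder `hsq` of packet C
(`Supersingular/TamParityChi8.lean`, `conductor_emod_eight_of_supersingular_two`).

CENSUS (EVIDENCE, not used): lens-4 `code/tam_square_law.py` over Cremona `allbsd`, N < 500 000: `|Δ_min| = N·k²` on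
308 209 / 308 209 Tam-odd curves, 0 exceptions (`HOME/b2b-bsdres-o1-idea-4-g7/data/TAMSQ-law.txt`); refuter v11 §65:
1 218 / 1 218 Tam-odd O1 rows. CREDIT: the symbol-level case analysis of §1 is lens-4's seat sketch
`HOME/b2b-bsdres-o1-idea-4-g7/lean/SketchG7Delta.lean` (`odd_numComponents_of_odd_tamagawa`, farm rc 0, never
proposed; one-writer rule), here run directly on the tree's discharged table facts instead of a `possibleTamagawa`
table-`def`, so that this file introduces no definition. PRESEARCH (lens-4 §4.42: nearest
[corpus:paper:dokchitser2010-birch-swinnerton-dyer-quotients-modulo-squares p0012 §3], Tamagawa numbers vs local root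
numbers — not this statement; re-run by this seat 2026-08-21: corpus hybrid "Tamagawa number odd minimal discriminant
conductor perfect square Kodaira type components parity" → [corpus:book:cohen1993-course-computational-algebraic-number-theory
p0460] (Tate's algorithm table) and [corpus:book:cornell1997-modular-forms-fermats-last-theorem p0580], neither states the
lemma; galaxy `--star all` "Tamagawa number is odd|odd Tamagawa|Tamagawa numbers are odd" → 0 hits): an elementary
consequence of two textbook theorems, apparently unrecorded in this form — a LEMMA OF THE CELL, not literature;
nothing is booked, no RESIDUAL-MAP mark moves.

References: J. Tate, LNM 476 (1975) 33–52 (the algorithm); J. H. Silverman, ATAEC, GTM 151 (1994), §IV.9 Table 4.1,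
Cor. 9.2, Algorithm 9.4, §IV.11 (11.1) (Ogg's formula); A. P. Ogg, Amer. J. Math. 89 (1967) 1–21; T. Saito, Duke
Math. J. 57 (1988) 151–173.
-/

set_option autoImplicit false

noncomputable section

open scoped Classical

open IsDedekindDomain NumberField WeierstrassCurve
open Literature.NumberTheory.DiophantineGeometry Literature.NumberTheory.EllipticCurves

namespace Summit.BirchSwinnertonDyer.Rank1Residual.Supersingular

/-! ## §0. Two arithmetic helpers -/

/-- A natural number all of whose prime-factorisation exponents are even is a square. [folklore] -/
theorem isSquare_of_forall_even_factorization {n : ℕ} (hn : n ≠ 0) (h : ∀ p, Even (n.factorization p)) :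
    IsSquare n := by
  refine ⟨n.factorization.prod fun p k => p ^ (k / 2), ?_⟩
  rw [← Finsupp.prod_mul]
  conv_lhs => rw [← Nat.prod_factorization_pow_eq_self hn]
  apply Finsupp.prod_congr
  intro p _
  rw [← pow_add]
  congr 1
  obtain ⟨t, ht⟩ := h p
  omega

/-- A natural number that is a square in `ℤ` up to its sign: `(n : ℤ) = m²` for `IsSquare n`. [folklore] -/
theorem exists_intCast_eq_sq_of_isSquare {n : ℕ} (h : IsSquare n) : ∃ m : ℤ, (n : ℤ) = m ^ 2 := by
  obtain ⟨r, hr⟩ := h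
  exact ⟨r, by rw [hr]; push_cast; ring⟩

/-! ## §1. Place by place: `c_v` odd ⇒ `m_v` odd ⇒ `f_v + ord_v(Δ_min)` even -/

section Local

variable {A : Type*} [CommRing A] [IsDedekindDomain A] {K : Type*} [Field K] [Algebra A K]
  [IsFractionRing A K] (v : HeightOneSpectrum A) (W : WeierstrassCurve K)

/-- **Kodaira–Néron–Tate table, parity column: an odd local index `c_v = [E(K_v) : E₀(K_v)]` forces an odd
number `m_v` of components of the special fibre.** Case analysis on the output `W.kodairaSymbolAt v` of Tate's
algorithm against the tree's discharged table: `III`, `III*` give `c_v = 2` and `Iₙ*` (`n ≥ 1`) gives `c_v ∈ {2, 4}`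
(contradiction), `Iₙ` gives `c_v = n` (split) or `c_v ∈ {1, 2}` by the parity of `n = ord_v(Δ_min)` (non-split), and
`I₀, II, IV, I₀*, IV*, II*` have `m_v ∈ {1, 1, 3, 5, 7, 9}`. Finite residue field (the non-split case; perfectness,
the standing hypothesis of the other table facts, follows). [cite: SilvermanATAEC1994, IV.9.4 (PDF pp. 341–346) with
Table 4.1 and Rem. IV.9.3] -/
theorem odd_numComponentsAt_of_odd_localTamagawaNumber [W.IsElliptic]
    [Finite (IsLocalRing.ResidueField (v.adicCompletionIntegers K))]
    (hodd : Odd ((W.baseChange (v.adicCompletion K)).localTamagawaNumber (v.adicCompletionIntegers K))) :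
    Odd (W.numComponentsAt v) := by
  haveI : PerfectField (IsLocalRing.ResidueField (v.adicCompletionIntegers K)) := PerfectField.ofFinite
  unfold WeierstrassCurve.numComponentsAt
  rcases hk : W.kodairaSymbolAt v with (_ | n) | _ | _ | _ | (_ | n) | _ | _ | _
  · -- `I₀`: one component
    simp [KodairaSymbol.numComponents]
  · -- `Iₙ`, `n ≥ 1`: multiplicative, `n = ord_v(Δ_min)`; split `c = n`, non-split `c = 1 / 2` by parity of `n`
    simp only [KodairaSymbol.numComponents]
    obtain ⟨hmult, hn⟩ := (W.kodairaSymbolAt_eq_I_iff_holds v (n := n + 1) (by omega)).mp hk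
    by_cases hs : W.HasSplitMultiplicativeReductionAt v
    · rwa [localTamagawaNumber_eq_ordMinimalDiscriminant_of_hasSplitMultiplicativeReductionAt v W hs, hn] at hodd
    · rw [localTamagawaNumber_of_hasNonsplitMultiplicativeReductionAt_holds v W hmult hs, hn] at hodd
      by_contra hne
      rw [Nat.not_odd_iff_even] at hne
      rw [if_pos hne] at hodd
      exact absurd hodd (by decide)
  · -- `II`
    simp [KodairaSymbol.numComponents]
  · -- `III`: `c = 2`
    have h2 := localTamagawaNumber_eq_two_of_kodairaSymbolAt_eq_III_holds v W hk
    rw [h2] at hodd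
    exact absurd hodd (by decide)
  · -- `IV`
    simp only [KodairaSymbol.numComponents]; decide
  · -- `I₀*`
    simp only [KodairaSymbol.numComponents]; decide
  · -- `Iₙ*`, `n ≥ 1`: `c ∈ {2, 4}`
    rcases localTamagawaNumber_of_kodairaSymbolAt_eq_Istar_succ_holds v W n hk with h | h <;>
      rw [h] at hodd <;> exact absurd hodd (by decide)
  · -- `IV*`
    simp only [KodairaSymbol.numComponents]; decide
  · -- `III*`: `c = 2`
    have h2 := localTamagawaNumber_eq_two_of_kodairaSymbolAt_eq_IIIstar_holds v W hk
    rw [h2] at hodd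
    exact absurd hodd (by decide)
  · -- `II*`
    simp only [KodairaSymbol.numComponents]; decide

/-- **LEMMA G7-Δ place by place: `c_v` odd ⇒ `f_v + ord_v(Δ_min)` is even** (`= 2·ord_v(Δ_min) + 1 − m_v` with
`m_v` odd, by Ogg's formula — the tree's definition of `f_v` — and `m_v ≤ ord_v(Δ_min) + 1`,
`WeierstrassCurve.numComponentsAt_le_holds`). [cite: SilvermanATAEC1994, IV.11.1 (Ogg's formula)] -/
theorem even_ordMinimalDiscriminant_add_conductorExponent_of_odd_localTamagawaNumber [W.IsElliptic]
    [Finite (IsLocalRing.ResidueField (v.adicCompletionIntegers K))]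
    (hodd : Odd ((W.baseChange (v.adicCompletion K)).localTamagawaNumber (v.adicCompletionIntegers K))) :
    Even (W.ordMinimalDiscriminant v + W.conductorExponent v) := by
  haveI : PerfectField (IsLocalRing.ResidueField (v.adicCompletionIntegers K)) := PerfectField.ofFinite
  obtain ⟨j, hj⟩ := odd_numComponentsAt_of_odd_localTamagawaNumber v W hodd
  have hle : W.numComponentsAt v ≤ W.ordMinimalDiscriminant v + 1 := W.numComponentsAt_le_holds v
  refine ⟨W.ordMinimalDiscriminant v - j, ?_⟩
  unfold WeierstrassCurve.conductorExponent
  omega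

end Local

/-! ## §2. Over `ℚ`: `Tam(E)` odd ⇒ every `c_v` odd ⇒ `N_E · |Δ_min|` is a square -/

section Rat

open Rat.HeightOneSpectrum

variable (W : WeierstrassCurve ℚ) [W.IsElliptic]

/-- The local Tamagawa factors of an elliptic `W / ℚ` have finite multiplicative support (they are `1` at the places
of good reduction, `ord_v(Δ_min) = 0`). [folklore] -/
theorem finite_mulSupport_localTamagawaNumber :
    (Function.mulSupport fun v : HeightOneSpectrum (𝓞 ℚ) =>
      (W.baseChange (v.adicCompletion ℚ)).localTamagawaNumber (v.adicCompletionIntegers ℚ)).Finite := by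
  have hfin : {v : HeightOneSpectrum (𝓞 ℚ) | W.ordMinimalDiscriminant v ≠ 0}.Finite :=
    W.finite_setOf_ordMinimalDiscriminant_ne_zero_holds (A := 𝓞 ℚ)
  refine hfin.subset fun v hv => ?_
  rw [Set.mem_setOf_eq]
  exact fun h0 => hv (localTamagawaNumber_eq_one_of_ordMinimalDiscriminant_eq_zero W v h0)

/-- **`Tam(E)` odd ⇒ every local factor `c_v` is odd** (`c_v ∣ Tam(E)`, a finite product). [folklore] -/
theorem odd_localTamagawaNumber_of_odd_tamagawaProduct (hodd : Odd W.tamagawaProduct)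
    (v : HeightOneSpectrum (𝓞 ℚ)) :
    Odd ((W.baseChange (v.adicCompletion ℚ)).localTamagawaNumber (v.adicCompletionIntegers ℚ)) :=
  hodd.of_dvd_nat (finprod_mem_dvd v (finite_mulSupport_localTamagawaNumber W))

/-- **LEMMA G7-Δ, exponent form over `ℚ`: `Tam(E)` odd ⇒ `v_p(N_E) + v_p(|Δ_min|)` is even for every `p`**
(i.e. `v_p(N_E) ≡ v_p(Δ_min) (mod 2)`; lens-4 4.36 (a) / refuter v11 §65 / typer item (26a) core). For `p` not prime
both exponents vanish. [cite: SilvermanATAEC1994, IV.9.4 Table 4.1 and IV.11.1] -/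
theorem even_factorization_conductorNorm_add_factorization_minimalDiscriminantNorm
    (hodd : Odd W.tamagawaProduct) (p : ℕ) :
    Even ((W.conductorNorm ℤ).factorization p + (W.minimalDiscriminantNorm ℤ).factorization p) := by
  by_cases hp : p.Prime
  · -- the places of `𝓞 ℚ` and of `ℤ` above `p`
    set v : HeightOneSpectrum (𝓞 ℚ) := (primesEquiv (R := 𝓞 ℚ)).symm ⟨p, hp⟩ with hv
    set vZ : HeightOneSpectrum ℤ := (primesEquiv (R := ℤ)).symm ⟨p, hp⟩ with hvZ
    have hpv : (primesEquiv v : ℕ) = p := by rw [hv, Equiv.apply_symm_apply]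
    have hpvZ : (primesEquiv vZ : ℕ) = p := by rw [hvZ, Equiv.apply_symm_apply]
    have hgen : natGenerator v = p := hpv
    have hgenZ : natGenerator vZ = p := hpvZ
    haveI : Fact p.Prime := ⟨hp⟩
    -- `v_p(N_E) = f_{vZ} = f_v` and `v_p(|Δ_min|) = ord_v(Δ_min)`
    have hN : (W.conductorNorm ℤ).factorization p = W.conductorExponent v := by
      rw [← hgenZ, W.factorization_conductorNorm_holds vZ]
      refine (WeierstrassCurve.conductorExponent_eq_of_primesEquiv_eq v vZ W ?_).symm
      exact Subtype.ext (hpv.trans hpvZ.symm)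
    have hΔ : (W.minimalDiscriminantNorm ℤ).factorization p = W.ordMinimalDiscriminant v := by
      rw [← hgen, ordMinimalDiscriminant_ringOfIntegers_eq_factorization W v]
    rw [hN, hΔ, add_comm]
    exact even_ordMinimalDiscriminant_add_conductorExponent_of_odd_localTamagawaNumber v W
      (odd_localTamagawaNumber_of_odd_tamagawaProduct W hodd v)
  · simp [Nat.factorization_eq_zero_of_not_prime _ hp]

/-- **THE TAMAGAWA-PARITY SQUARE LEMMA: `Tam(E)` odd ⇒ `N_E · |Δ_min|` is a perfect square** (`N_E =
W.conductorNorm ℤ`, `|Δ_min| = W.minimalDiscriminantNorm ℤ`). [cite: SilvermanATAEC1994, IV.9.4 Table 4.1 and IV.11.1] -/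
theorem isSquare_conductorNorm_mul_minimalDiscriminantNorm (hodd : Odd W.tamagawaProduct) :
    IsSquare (W.conductorNorm ℤ * W.minimalDiscriminantNorm ℤ) := by
  have hN0 : W.conductorNorm ℤ ≠ 0 := (W.conductorNorm_pos_holds).ne'
  have hΔ0 : W.minimalDiscriminantNorm ℤ ≠ 0 := (W.minimalDiscriminantNorm_pos_holds).ne'
  refine isSquare_of_forall_even_factorization (mul_ne_zero hN0 hΔ0) fun p => ?_
  rw [Nat.factorization_mul hN0 hΔ0, Finsupp.add_apply]
  exact even_factorization_conductorNorm_add_factorization_minimalDiscriminantNorm W hodd p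

/-- **Equivalently: `|Δ_min| = N_E · k²`** (the printed shape of lens-4's G7-Δ, `k = ∏ p^{(m_p − 1)/2}`; here only the
existence of `k`: `N_E ∣ |Δ_min|` and the quotient has even exponents). [cite: SilvermanATAEC1994, IV.9.4 Table 4.1 and IV.11.1] -/
theorem exists_minimalDiscriminantNorm_eq_conductorNorm_mul_sq (hodd : Odd W.tamagawaProduct) :
    ∃ k : ℕ, W.minimalDiscriminantNorm ℤ = W.conductorNorm ℤ * k ^ 2 := by
  have hN0 : W.conductorNorm ℤ ≠ 0 := (W.conductorNorm_pos_holds).ne'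
  obtain ⟨q, hq⟩ : W.conductorNorm ℤ ∣ W.minimalDiscriminantNorm ℤ :=
    W.conductorNorm_dvd_minimalDiscriminantNorm (W.finite_setOf_ordMinimalDiscriminant_ne_zero_holds (A := ℤ))
  have hsq : IsSquare (W.conductorNorm ℤ * W.minimalDiscriminantNorm ℤ) :=
    isSquare_conductorNorm_mul_minimalDiscriminantNorm W hodd
  rw [hq, ← mul_assoc] at hsq
  -- `N² · q` a square ⇒ `q` a square
  have hq0 : q ≠ 0 := by
    rintro rfl
    exact (W.minimalDiscriminantNorm_pos_holds).ne' (by rw [hq, mul_zero])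
  have hqsq : IsSquare q := by
    refine isSquare_of_forall_even_factorization hq0 fun p => ?_
    have h := (Nat.factorization_mul (mul_ne_zero hN0 hN0) hq0) ▸
      (show ∀ p, Even ((W.conductorNorm ℤ * W.conductorNorm ℤ * q).factorization p) from fun p => by
        obtain ⟨r, hr⟩ := hsq
        have hr0 : r ≠ 0 := by
          rintro rfl
          exact mul_ne_zero (mul_ne_zero hN0 hN0) hq0 (by rw [hr, mul_zero])
        rw [hr, Nat.factorization_mul hr0 hr0, Finsupp.add_apply]
        exact ⟨_, rfl⟩) p
    rw [Finsupp.add_apply, Nat.factorization_mul hN0 hN0, Finsupp.add_apply] at h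
    obtain ⟨t, ht⟩ := h
    exact ⟨t - (W.conductorNorm ℤ).factorization p, by omega⟩
  obtain ⟨k, hk⟩ := hqsq
  exact ⟨k, by rw [hq, hk, sq]⟩

/-- **Integer form for a globally minimal model — packet C's binder `hsq`: `N_E · |minimalDiscriminantInt W| = m²`**
(`minimalDiscriminantInt W = (integralModelInt W).Δ`, and `W.minimalDiscriminantNorm ℤ = |minimalDiscriminantInt W|` by
the discharged `minimalDiscriminantNorm_int_eq_natAbs_minimalDiscriminantInt_holds`). Feeds
`conductor_emod_eight_of_supersingular_two (integralModelInt W)` of `Supersingular/TamParityChi8.lean`.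
[cite: SilvermanATAEC1994, IV.9.4 Table 4.1 and IV.11.1] -/
theorem exists_conductorNorm_mul_abs_minimalDiscriminantInt_eq_sq [W.IsGloballyMinimal]
    (hodd : Odd W.tamagawaProduct) :
    ∃ m : ℤ, (W.conductorNorm ℤ : ℤ) * |minimalDiscriminantInt W| = m ^ 2 := by
  obtain ⟨m, hm⟩ := exists_intCast_eq_sq_of_isSquare (isSquare_conductorNorm_mul_minimalDiscriminantNorm W hodd)
  refine ⟨m, ?_⟩
  rw [← hm, W.minimalDiscriminantNorm_int_eq_natAbs_minimalDiscriminantInt_holds, Nat.cast_mul,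
    Int.natCast_natAbs]

/-- The same with packet C's literal `Δ` of the integral model: `N_E · |(integralModelInt W).Δ| = m²`. [folklore] -/
theorem exists_conductorNorm_mul_abs_Δ_integralModelInt_eq_sq [W.IsGloballyMinimal]
    (hodd : Odd W.tamagawaProduct) :
    ∃ m : ℤ, (W.conductorNorm ℤ : ℤ) * |(integralModelInt W).Δ| = m ^ 2 :=
  exists_conductorNorm_mul_abs_minimalDiscriminantInt_eq_sq W hodd

end Rat

end Summit.BirchSwinnertonDyer.Rank1Residual.Supersingular

end
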